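import Summits.BirchSwinnertonDyer.BirchSwinnertonDyer.Theorems.ErratumRoadFiveEulerHalfAuxNormE0PrimeOfTrace
import Summits.BirchSwinnertonDyer.BirchSwinnertonDyer.Theorems.ErratumRoadFiveEulerHalfModularHeegnerFamilyTrace
import Summits.BirchSwinnertonDyer.BirchSwinnertonDyer.Theorems.ErratumRoadFiveAuxNormReceptacle
import Summits.BirchSwinnertonDyer.BirchSwinnertonDyer.Theorems.ErratumRoadFiveAuxNormRelativeStabilizerLaw
import Summits.BirchSwinnertonDyer.BirchSwinnertonDyer.Theorems.ErratumRoadFiveAuxPrimeSupply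
import HarnessLib

/-!
# Gross's E′-LABEL at a K-split carrier for the X₀(N) Kolyvagin–Heegner family — the «modular aux-norm» composition
# (the auxiliary-norm lever of bsd-idea-9, kernel core p641143 ∕ its family-generic form, fed with the MODULAR family's (B4))
# Cell `bsd-stepL`, seat `bsd-line-er5-p1-w5` g0 (width seat on crux 19715 `EulerHalfNotRamNoInertSetAtFive`, line `birth`);
# `--supports stmt-BirchSwinnertonDyer-19715 --as helper` (route-free; generic prime `p ≥ 5`, generic K-split carrier `q`)

WHY. The S1b branch of crux 19715 (`p` the only multiplicative prime, a split carrier) feeds its `hGZ` receptacle binder from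
[GZ86 III (3.1)] (`Gross1991_heegnerPoint_sub_ratTorsion_mem_E0_imageFree`, conjunct 2 of item 27981, primary text not held). The
auxiliary-norm lever produces the SAME kind of input — a prime-to-`p` multiple `n' • y(m)` in `E₀(K[m])_w` at every place `w` over a
K-split carrier `q` — from (B4) + two local E₀-facts (T), (C) + an auxiliary inert level (AUX). THIS FILE composes the landed pieces
for the MODULAR family: (B4) = `ModularAuxNorm.exists_modularHeegnerFamily_trace` (Gross Prop. 3.7 (1) at EVERY inert good level, a
kernel theorem), AUX = `AuxNormReceptacle.auxiliaryInertLevel_of_laws` (LEAD er5-p1 g3, p644422) ∘ `AuxNormReceptacle.relativeStabilizerLaw`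
(-w4 g8, p642411) ∘ `AuxPrimeSupply.auxiliaryPrimeSupply` (-w2 g5, p645521: Chebotarev in `K(E[p^E], γ^{1/p})/ℚ` under `ρ̄_{E,p}` onto,
`p ≥ 5`, `d_K < −4`), the core = `ShimuraWalk.labelE0Prime_at_carrier_of_trace_of_galTrivial_of_kills_of_auxLevel` (sibling file). The two
LOCAL inputs (T) «`Aut_ℚ(K[n])_w` acts trivially on `E(K[n]) ∕ E₀,w`» and (C) «`c` kills `E(K[n]) ∕ E₀,w`» stay HYPOTHESES here (their
discharge at an odd prime `p ∣ c_q` is width seat -w6 g0's `CarrierLocalE0OddPrime.carrierLocalE0_ringClassField_of_odd_prime_dvd`,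
ported from tam3-p1 g18's p643818 ∕ p644399; plugged in the sequel `…ModularHGZOfAuxNorm`).

WHAT. `exists_modularFamily_labelE0Prime_at_carrier_of_galTrivial_of_kills`: `W/ℚ` globally minimal elliptic of conductor `N = N_E`,
`K` imaginary quadratic with `d_K < −4` and `gcd(N, d_K) = 1`, `ι`, its ring class tower `K[·] ⊂ ℂ` (number fields), a prime `p ≥ 5` with
`ρ̄_{E,p}` onto, a prime `q ∣ N` SPLIT in `K`, `c ≠ 0`, (T) and (C) at `(q, c)`, a datum `Dt` at level `N`, an orientation `β` ⟹ a family
`ys : (m : ℕ) → E(K[m])` over `φ(x(m))` (`m ≠ 0`) AND one `n'` prime to `p` with `n' • ys m ∈ E₀(K[m])_w` at every square-free `m` with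
inert good prime factors and every `w ∋ q`. Heegner-hypothesis form `…_of_satisfiesHeegnerHypothesis`.

HONEST FRAMING: THEOREMS ONLY (no definition, no named fact, no instance, no `sorry`); (T), (C) are HYPOTHESES; nothing about Selmer
groups or `L`-values; no stub ∕ item closes; 19715 is not closed by this; BSD is proved for no curve (T7); no summit statement is touched.
References (locators only): [cite: GrossLMS1991, §3 Prop. 3.7 (1) (p. 239), §6 proof of Prop. 6.2 (1) (p. 245 «E′»)]
[cite: Cox2013, §7.D Thm. 7.24, §8 Thm. 8.12, §9.A] [cite: SilvermanATAEC1994, IV Cor. 9.2 (d)].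
presearch: n/a beyond the sibling files (pure composition of landed theorems; mechanism = bsd-idea-9's card `aux-norm-receptacle`).
Axioms: `propext`, `Classical.choice`, `Quot.sound`.
-/

set_option autoImplicit false
set_option linter.dupNamespace false

noncomputable section

open scoped Classical NumberField Pointwise

namespace Summit.BirchSwinnertonDyer.BirchSwinnertonDyer.Theorems.ModularAuxNorm

open WeierstrassCurve IsDedekindDomain NumberField Field Literature.NumberTheory.EllipticCurves
  Literature.NumberTheory.EllipticCurves.ModularForms

variable {K : Type} [Field K] [NumberField K]

/-- **The E′-label at a K-split carrier for the X₀(N) Kolyvagin–Heegner family, from (T), (C) and the landed aux-norm machinery.**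
`W/ℚ` globally minimal elliptic of conductor `N = N_E`; `K` imaginary quadratic, `d_K < −4`, `gcd(N, d_K) = 1`, ring class tower
`K[·] ⊂ ℂ`; `p ≥ 5` prime with `ρ̄_{E,p}` onto; `q ∣ N` a prime SPLIT in `K`; `c ≠ 0` with (T) (every `τ ∈ Aut_ℚ(K[n])` fixing a place
`w ∋ q`, `q ∤ n ≠ 0`, acts trivially on `E(K[n]) ∕ E₀,w`) and (C) (`c` kills `E(K[n]) ∕ E₀,w`); `Dt` a parametrisation datum at level `N`,
`β` an orientation. THEN there are the modular family `ys` (`ys m ↦ φ(x(m))` for `m ≠ 0`) and ONE `n'` prime to `p` with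
`n' • ys m ∈ E₀(K[m])_w` for every square-free `m` with inert good prime factors and every place `w ∋ q` of `K[m]` — Gross's «E′» at
the carrier WITHOUT [GZ86 III (3.1)]. Composition: (B4) `exists_modularHeegnerFamily_trace`; AUX `auxiliaryInertLevel_of_laws` ∘
`relativeStabilizerLaw` ∘ `auxiliaryPrimeSupply`; core `labelE0Prime_at_carrier_of_trace_of_galTrivial_of_kills_of_auxLevel`.
[cite: GrossLMS1991, §3 Prop. 3.7 (1), §6 p. 245] [cite: Cox2013, Thm. 7.24, Thm. 8.12] -/
theorem exists_modularFamily_labelE0Prime_at_carrier_of_galTrivial_of_kills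
    (W : WeierstrassCurve ℚ) [W.IsElliptic] [W.IsGloballyMinimal] [NeZero (W.conductorNorm ℤ)]
    (ι : K →+* ℂ) [∀ j : ℕ, NumberField (ringClassField K ι j)]
    (hK : IsImaginaryQuadratic K) (hD : NumberField.discr K < -4)
    (hND : IsCoprime (W.conductorNorm ℤ : ℤ) (NumberField.discr K))
    {p : ℕ} [Fact p.Prime] (hp5 : 5 ≤ p) (hsurj : W.HasSurjectiveModNGaloisRep p)
    (q : ℕ) [Fact q.Prime] (hqN : q ∣ W.conductorNorm ℤ)
    (hq2 : ((Ideal.span {(q : ℤ)}).primesOver (𝓞 K)).ncard = 2)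
    {c : ℕ} (hc0 : c ≠ 0)
    (hT : ∀ n : ℕ, n ≠ 0 → ¬ q ∣ n → ∀ (w : HeightOneSpectrum (𝓞 (ringClassField K ι n))),
      ((q : ℕ) : 𝓞 (ringClassField K ι n)) ∈ w.asIdeal →
      ∀ τ : ringClassField K ι n ≃ₐ[ℚ] ringClassField K ι n, τ • w.asIdeal = w.asIdeal →
      ∀ P : (W.baseChange (ringClassField K ι n)).toAffine.Point,
        (placeIntModel W (ringClassField K ι n) w).HasNonsingularReduction (K := ringClassField K ι n)
          (pointGalHom W (ringClassField K ι n) τ P - P))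
    (hC : ∀ n : ℕ, n ≠ 0 → ¬ q ∣ n → ∀ (w : HeightOneSpectrum (𝓞 (ringClassField K ι n))),
      ((q : ℕ) : 𝓞 (ringClassField K ι n)) ∈ w.asIdeal →
      ∀ P : (W.baseChange (ringClassField K ι n)).toAffine.Point,
        (placeIntModel W (ringClassField K ι n) w).HasNonsingularReduction (K := ringClassField K ι n) (c • P))
    (Dt : ModularParametrizationData W (W.conductorNorm ℤ)) (β : ℤ)
    (hβ : (4 * (W.conductorNorm ℤ : ℕ) : ℤ) ∣ β ^ 2 - NumberField.discr K) :
    ∃ ys : (m : ℕ) → (W.baseChange (ringClassField K ι m)).toAffine.Point,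
      (∀ m : ℕ, m ≠ 0 →
        WeierstrassCurve.Affine.Point.map (W' := W) (ringClassField K ι m).subtype.toRatAlgHom (ys m) =
          heegnerPointComplexOfConductor Dt (NumberField.discr K) β m) ∧
      ∃ n' : ℕ, ¬ p ∣ n' ∧ ∀ m : ℕ, Squarefree m →
        (∀ r ∈ m.primeFactors, ¬ r ∣ W.conductorNorm ℤ ∧ (Ideal.span {(r : 𝓞 K)}).IsPrime) →
        ∀ [NumberField (ringClassField K ι m)] (w : HeightOneSpectrum (𝓞 (ringClassField K ι m))),
          ((q : ℕ) : 𝓞 (ringClassField K ι m)) ∈ w.asIdeal →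
          (placeIntModel W (ringClassField K ι m) w).HasNonsingularReduction (K := ringClassField K ι m) (n' • ys m) := by
  -- (B4) for the modular family
  obtain ⟨ys, hys, hB4⟩ := exists_modularHeegnerFamily_trace W hK hD hND ι Dt β hβ
  -- AUX at `(p, q, N_E)` from S2♭ (ring class CFT) and S3♭ (Chebotarev–Kummer supply under `ρ̄` onto, `p ≥ 5`, `d_K < −4`)
  have hAux : AuxNormReceptacle.AuxiliaryInertLevel W K ι p q (W.conductorNorm ℤ) :=
    AuxNormReceptacle.auxiliaryInertLevel_of_laws W K ι hK hqN (AuxNormReceptacle.relativeStabilizerLaw hK ι q)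
      (AuxPrimeSupply.auxiliaryPrimeSupply W K hK hD p hp5 hsurj q hq2 (W.conductorNorm ℤ) (NeZero.ne _))
  exact ⟨ys, hys, ShimuraWalk.labelE0Prime_at_carrier_of_trace_of_galTrivial_of_kills_of_auxLevel W ι hK hqN hc0 ys hB4 hT hC hAux⟩

/-- **The same under the Heegner hypothesis** (`gcd(N, d_K) = 1` because every prime of `N` splits in `K`).
[cite: GrossLMS1991, §1 p. 235, §6 p. 245] -/
theorem exists_modularFamily_labelE0Prime_at_carrier_of_galTrivial_of_kills_of_satisfiesHeegnerHypothesis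
    (W : WeierstrassCurve ℚ) [W.IsElliptic] [W.IsGloballyMinimal] [NeZero (W.conductorNorm ℤ)]
    (ι : K →+* ℂ) [∀ j : ℕ, NumberField (ringClassField K ι j)]
    (hK : IsImaginaryQuadratic K) (hD : NumberField.discr K < -4)
    (hH : SatisfiesHeegnerHypothesis (W.conductorNorm ℤ) K)
    {p : ℕ} [Fact p.Prime] (hp5 : 5 ≤ p) (hsurj : W.HasSurjectiveModNGaloisRep p)
    (q : ℕ) [Fact q.Prime] (hqN : q ∣ W.conductorNorm ℤ)
    (hq2 : ((Ideal.span {(q : ℤ)}).primesOver (𝓞 K)).ncard = 2)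
    {c : ℕ} (hc0 : c ≠ 0)
    (hT : ∀ n : ℕ, n ≠ 0 → ¬ q ∣ n → ∀ (w : HeightOneSpectrum (𝓞 (ringClassField K ι n))),
      ((q : ℕ) : 𝓞 (ringClassField K ι n)) ∈ w.asIdeal →
      ∀ τ : ringClassField K ι n ≃ₐ[ℚ] ringClassField K ι n, τ • w.asIdeal = w.asIdeal →
      ∀ P : (W.baseChange (ringClassField K ι n)).toAffine.Point,
        (placeIntModel W (ringClassField K ι n) w).HasNonsingularReduction (K := ringClassField K ι n)
          (pointGalHom W (ringClassField K ι n) τ P - P))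
    (hC : ∀ n : ℕ, n ≠ 0 → ¬ q ∣ n → ∀ (w : HeightOneSpectrum (𝓞 (ringClassField K ι n))),
      ((q : ℕ) : 𝓞 (ringClassField K ι n)) ∈ w.asIdeal →
      ∀ P : (W.baseChange (ringClassField K ι n)).toAffine.Point,
        (placeIntModel W (ringClassField K ι n) w).HasNonsingularReduction (K := ringClassField K ι n) (c • P))
    (Dt : ModularParametrizationData W (W.conductorNorm ℤ)) (β : ℤ)
    (hβ : (4 * (W.conductorNorm ℤ : ℕ) : ℤ) ∣ β ^ 2 - NumberField.discr K) :
    ∃ ys : (m : ℕ) → (W.baseChange (ringClassField K ι m)).toAffine.Point,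
      (∀ m : ℕ, m ≠ 0 →
        WeierstrassCurve.Affine.Point.map (W' := W) (ringClassField K ι m).subtype.toRatAlgHom (ys m) =
          heegnerPointComplexOfConductor Dt (NumberField.discr K) β m) ∧
      ∃ n' : ℕ, ¬ p ∣ n' ∧ ∀ m : ℕ, Squarefree m →
        (∀ r ∈ m.primeFactors, ¬ r ∣ W.conductorNorm ℤ ∧ (Ideal.span {(r : 𝓞 K)}).IsPrime) →
        ∀ [NumberField (ringClassField K ι m)] (w : HeightOneSpectrum (𝓞 (ringClassField K ι m))),
          ((q : ℕ) : 𝓞 (ringClassField K ι m)) ∈ w.asIdeal →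
          (placeIntModel W (ringClassField K ι m) w).HasNonsingularReduction (K := ringClassField K ι m) (n' • ys m) := by
  have hND : IsCoprime (W.conductorNorm ℤ : ℤ) (NumberField.discr K) := by
    refine Int.isCoprime_iff_gcd_eq_one.mpr ?_
    rw [Int.gcd_eq_natAbs, Int.natAbs_natCast]
    exact Literature.SatisfiesHeegnerHypothesis.coprime_discr hK.1 hH
  exact exists_modularFamily_labelE0Prime_at_carrier_of_galTrivial_of_kills W ι hK hD hND hp5 hsurj q hqN hq2 hc0 hT hC Dt β hβ

end Summit.BirchSwinnertonDyer.BirchSwinnertonDyer.Theorems.ModularAuxNorm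

end
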